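import Mathlib
import Summits.Ventures.HodgeRepro2.T5SchurBridge
import Summits.Ventures.HodgeRepro2.T5RestrictionRep

/-!
# T5Multiplicity — the character multiplicity formula for compact groups (kernel form)

Tier-5 support (seat p1, cell pub-hodge-repro2); the capstone of the Schur group
(`T5SchurOrthogonality` p394792 · `T5SchurMathlib` p394891 · `T5UnitarianTrick` p394970 ·
`T5SchurBridge` p395005 · `T5SchurFinite` p395014 · `T5CompleteReducibility` p395089 ·
`T5RestrictionRep` p395172): the tool behind every «this K-type occurs exactly once» sentence of
N4.3 (P2′) — for a finite-dimensional continuous unitary representation `π` of a compact group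
and an irreducible unitary `σ`, the integral `∫ χ_π · conj χ_σ dμ` is the NUMBER of summands
equivalent to `σ` in an (any) orthogonal decomposition of `π` into irreducibles.

Printed source: Goodman–Wallach GTM 255, the corollaries of the Schur orthogonality relations
(Lemma 4.3.3, p. 208; compact form §7.3.4, p. 360): «the character of a representation is the sum
of the characters of its irreducible constituents … the multiplicity is read off from the inner
product of characters» — the cell's own derivation from the landed relations; no new printed
input.

* `toLinearMap_eq_conj`, `character_eq_of_equiv`: equivalent representations (Mathlib's
  `Representation.Equiv`) have equal characters (`LinearMap.trace_conj'`);
* `restrictCLM_eq_orthogonalProjection_comp`, `continuous_restrictRep`, `continuous_character`: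
  the restriction to a stable subspace of a continuous representation is continuous;
* `integral_character_mul_conj_eq_card`, `integral_character_mul_conj_eq_card'`: for a
  decomposition `S` (pairwise orthogonal irreducible stable subspaces, internal direct sum),
  `∫ χ_π · conj χ_σ dμ = #{W ∈ S : π|W ≃ σ}`;
* `exists_decomposition_integral_character_eq_card`: the existence form — every continuous unitary
  `π` has such a decomposition, and the integral counts the summands equivalent to every
  irreducible unitary `σ` (the multiplicity of `σ` in `π`). In particular the count does not depend
  on the decomposition.

Honest scope: compact groups and finite-dimensional representations only; the K-types of the
discrete series of `U(1,1)` (infinite-dimensional, non-compact group) are not addressed.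
-/

noncomputable section
namespace Summit.Ventures.HodgeRepro2.T5Multiplicity

open Summit.Ventures.HodgeRepro2.T5SchurOrthogonality
open Summit.Ventures.HodgeRepro2.T5SchurMathlib

section equiv

variable {G : Type*} [Group G]
variable {W₀ W : Type*} [NormedAddCommGroup W₀] [InnerProductSpace ℂ W₀] [NormedAddCommGroup W]
  [InnerProductSpace ℂ W]

/-- An equivalence `e : σ ≃ τ` conjugates the operators: `τ g = e ∘ σ g ∘ e⁻¹`. -/
theorem toLinearMap_eq_conj (σ : G →* (W₀ →L[ℂ] W₀)) (τ : G →* (W →L[ℂ] W))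
    (e : Representation.Equiv (toRep σ) (toRep τ)) (g : G) :
    ((τ g : W →L[ℂ] W) : W →ₗ[ℂ] W) =
      e.toLinearEquiv.conj ((σ g : W₀ →L[ℂ] W₀) : W₀ →ₗ[ℂ] W₀) := by
  apply LinearMap.ext
  intro y
  have h1 := congrArg (fun f : W₀ →ₗ[ℂ] W => f (e.toLinearEquiv.symm y))
    (e.toIntertwiningMap.isIntertwining' g)
  simp only [LinearMap.comp_apply] at h1
  have h2 : ∀ x : W₀, e.toIntertwiningMap.toLinearMap x = e.toLinearEquiv x := fun _ => rfl
  rw [LinearEquiv.conj_apply]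
  simp only [LinearMap.comp_apply, LinearEquiv.coe_coe, ContinuousLinearMap.coe_coe]
  rw [h2, h2, LinearEquiv.apply_symm_apply] at h1
  exact h1.symm

/-- Equivalent representations have the same character. -/
theorem character_eq_of_equiv [FiniteDimensional ℂ W₀] [FiniteDimensional ℂ W]
    (σ : G →* (W₀ →L[ℂ] W₀)) (τ : G →* (W →L[ℂ] W))
    (e : Representation.Equiv (toRep σ) (toRep τ)) (g : G) : character τ g = character σ g := by
  unfold character
  rw [toLinearMap_eq_conj σ τ e g, LinearMap.trace_conj']

end equiv

open Summit.Ventures.HodgeRepro2.T5CompleteReducibility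
open Summit.Ventures.HodgeRepro2.T5RestrictionRep
open MeasureTheory ComplexConjugate
open scoped InnerProductSpace

variable {G : Type*} [Group G]
variable {V : Type*} [NormedAddCommGroup V] [InnerProductSpace ℂ V] [FiniteDimensional ℂ V]
variable (π : G →* (V →L[ℂ] V))

/-- The restriction to a stable subspace is the orthogonal projection composed with `π g` on
`W` (for a finite-dimensional `V`). -/
theorem restrictCLM_eq_orthogonalProjection_comp (W : Submodule ℂ V) (hW : IsStable π W)
    (g : G) :
    restrictCLM π W hW g = W.orthogonalProjectionOnto ∘L ((π g).comp W.subtypeL) := by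
  ext x
  show π g x = ((W.orthogonalProjectionOnto ((⟨π g x, hW g x x.2⟩ : W) : V)) : V)
  rw [Submodule.orthogonalProjectionOnto_mem_subspace_eq_self]

variable [TopologicalSpace G]

/-- The restricted representation is continuous when `π` is. -/
theorem continuous_restrictRep (hπ : Continuous π) (W : Submodule ℂ V) (hW : IsStable π W) :
    Continuous (restrictRep π W hW) := by
  have h : (restrictRep π W hW : G → (W →L[ℂ] W)) =
      fun g => W.orthogonalProjectionOnto ∘L ((π g).comp W.subtypeL) := by
    funext g
    exact restrictCLM_eq_orthogonalProjection_comp π W hW g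
  rw [h]
  have h1 : Continuous fun g : G => (π g).comp W.subtypeL :=
    (isBoundedBilinearMap_comp (𝕜 := ℂ) (E := W) (F := V) (G := V)).continuous.comp₂ hπ
      continuous_const
  exact (isBoundedBilinearMap_comp (𝕜 := ℂ) (E := W) (F := V) (G := W)).continuous.comp₂
    continuous_const h1

/-- Characters of continuous representations are continuous. -/
theorem continuous_character {W : Type*} [NormedAddCommGroup W] [InnerProductSpace ℂ W]
    [FiniteDimensional ℂ W] (τ : G →* (W →L[ℂ] W)) (hτ : Continuous τ) :
    Continuous (character τ) :=
  (traceCLM (V := W)).continuous.comp hτ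

variable [IsTopologicalGroup G] [MeasurableSpace G] [BorelSpace G] [CompactSpace G]

open scoped Classical in
/-- **The character multiplicity formula**: for an orthogonal decomposition `S` of `V` into
irreducible stable subspaces and an irreducible unitary `σ`,
`∫ χ_π · conj χ_σ dμ = #{W ∈ S : π|W ≃ σ}` — the number of summands equivalent to `σ`. -/
theorem integral_character_mul_conj_eq_card {W₀ : Type*} [NormedAddCommGroup W₀]
    [InnerProductSpace ℂ W₀] [FiniteDimensional ℂ W₀] (σ : G →* (W₀ →L[ℂ] W₀))
    (μ : Measure G) [IsProbabilityMeasure μ] [μ.IsMulLeftInvariant]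
    (hπ : Continuous π) (hσ : Continuous σ) (hσu : IsUnitary σ)
    [Representation.IsIrreducible (toRep σ)]
    (S : Finset (Submodule ℂ V)) (hirr : ∀ W ∈ S, IsIrreducibleSubspace π W)
    (hst : ∀ W ∈ S, IsStable π W)
    (hN : DirectSum.IsInternal (fun W : S => (W : Submodule ℂ V))) :
    ∫ g, character π g * conj (character σ g) ∂μ =
      ∑ W : S, (if Nonempty (Representation.Equiv (toRep σ)
        (toRep (restrictRep π W (hst W W.2)))) then (1 : ℂ) else 0) := by
  classical
  haveI : IsFiniteMeasureOnCompacts μ :=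
    isFiniteMeasure_iff_isFiniteMeasureOnCompacts_of_compactSpace.mp inferInstance
  haveI : Nontrivial W₀ := nontrivial_of_isIrreducible σ
  have hσirr : IsIrreducible σ := (isIrreducible_iff σ).mpr inferInstance
  -- characters add over the decomposition
  have hchar : ∀ g, character π g = ∑ W : S, character (restrictRep π W (hst W W.2)) g :=
    character_eq_sum_restrict_finset π S hN hst
  simp_rw [hchar, Finset.sum_mul]
  rw [integral_finsetSum _ (fun W _ => ?_)]
  · refine Finset.sum_congr rfl fun W _ => ?_
    haveI : Nontrivial W := nontrivial_of_isIrreducibleSubspace π W (hirr W W.2)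
    have hWirr : IsIrreducible (restrictRep π W (hst W W.2)) :=
      isIrreducible_restrictRep π W (hirr W W.2) (hst W W.2)
    haveI : Representation.IsIrreducible (toRep (restrictRep π W (hst W W.2))) :=
      (isIrreducible_iff _).mp hWirr
    split_ifs with h
    · -- equivalent: the characters agree, and ∫ |χ_σ|² = 1
      obtain ⟨e⟩ := h
      simp_rw [character_eq_of_equiv σ _ e]
      exact integral_character_mul_conj σ μ hσ hσu hσirr
    · -- inequivalent: orthogonality of characters
      haveI : IsEmpty (Representation.Equiv (toRep σ) (toRep (restrictRep π W (hst W W.2)))) :=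
        not_nonempty_iff.mp h
      exact integral_character_mul_conj_eq_zero (restrictRep π W (hst W W.2)) σ μ
        (continuous_restrictRep π hπ W (hst W W.2)) hσ hσu
  · exact ((continuous_character _ (continuous_restrictRep π hπ W (hst W W.2))).mul
      (Complex.continuous_conj.comp (continuous_character σ hσ))).integrable_of_hasCompactSupport
      (HasCompactSupport.of_compactSpace _)

open scoped Classical in
/-- The multiplicity formula as a count: `∫ χ_π · conj χ_σ dμ` is the NUMBER of summands of the
decomposition equivalent to `σ`. -/
theorem integral_character_mul_conj_eq_card' {W₀ : Type*} [NormedAddCommGroup W₀]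
    [InnerProductSpace ℂ W₀] [FiniteDimensional ℂ W₀] (σ : G →* (W₀ →L[ℂ] W₀))
    (μ : Measure G) [IsProbabilityMeasure μ] [μ.IsMulLeftInvariant]
    (hπ : Continuous π) (hσ : Continuous σ) (hσu : IsUnitary σ)
    [Representation.IsIrreducible (toRep σ)]
    (S : Finset (Submodule ℂ V)) (hirr : ∀ W ∈ S, IsIrreducibleSubspace π W)
    (hst : ∀ W ∈ S, IsStable π W)
    (hN : DirectSum.IsInternal (fun W : S => (W : Submodule ℂ V))) :
    ∫ g, character π g * conj (character σ g) ∂μ =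
      ((Finset.univ.filter fun W : S => Nonempty (Representation.Equiv (toRep σ)
        (toRep (restrictRep π W (hst W W.2))))).card : ℂ) := by
  rw [integral_character_mul_conj_eq_card π σ μ hπ hσ hσu S hirr hst hN, Finset.sum_boole]

open scoped Classical in
/-- **Existence form**: for a continuous unitary `π` on `V` there is an orthogonal decomposition
`S` of `V` into irreducible stable subspaces, and for every irreducible unitary `σ` the integral
`∫ χ_π · conj χ_σ dμ` counts the summands equivalent to `σ` (the multiplicity of `σ` in `π`). -/
theorem exists_decomposition_integral_character_eq_card (μ : Measure G) [IsProbabilityMeasure μ]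
    [μ.IsMulLeftInvariant] (hπ : Continuous π) (hu : IsUnitary π) :
    ∃ S : Finset (Submodule ℂ V), (∀ W ∈ S, IsIrreducibleSubspace π W) ∧
      (S : Set (Submodule ℂ V)).Pairwise (fun W W' => W ⟂ W') ∧
      ∃ hst : ∀ W ∈ S, IsStable π W,
      ∀ {W₀ : Type} [NormedAddCommGroup W₀] [InnerProductSpace ℂ W₀] [FiniteDimensional ℂ W₀]
        (σ : G →* (W₀ →L[ℂ] W₀)) (_ : Continuous σ) (_ : IsUnitary σ)
        [Representation.IsIrreducible (toRep σ)],
        ∫ g, character π g * conj (character σ g) ∂μ =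
          ((Finset.univ.filter fun W : S => Nonempty (Representation.Equiv (toRep σ)
            (toRep (restrictRep π W (hst W W.2))))).card : ℂ) := by
  obtain ⟨S, hirr, horth, hN⟩ := exists_isInternal_irreducible π hu
  have hst : ∀ W ∈ S, IsStable π W := fun W hW => (hirr W hW).2.1
  refine ⟨S, hirr, horth, hst, ?_⟩
  intro W₀ _ _ _ σ hσ hσu _
  exact integral_character_mul_conj_eq_card' π σ μ hπ hσ hσu S hirr hst hN

open scoped Classical in
/-- **Irreducibility criterion**: if `∫ |χ_π|² dμ = 1` then `π` is irreducible (for `V ≠ 0`):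
expanding the second factor over an orthogonal irreducible decomposition `S`, the integral is
`Σ_{W' ∈ S} #{W ∈ S : π|W ≃ π|W'} ≥ #S`, so `S` is a single summand `W = ⊤`. -/
theorem isIrreducible_of_integral_character_mul_conj_eq_one [Nontrivial V] (μ : Measure G)
    [IsProbabilityMeasure μ] [μ.IsMulLeftInvariant] (hπ : Continuous π) (hu : IsUnitary π)
    (h1 : ∫ g, character π g * conj (character π g) ∂μ = 1) : IsIrreducible π := by
  haveI : IsFiniteMeasureOnCompacts μ :=
    isFiniteMeasure_iff_isFiniteMeasureOnCompacts_of_compactSpace.mp inferInstance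
  obtain ⟨S, hirr, horth, hsup⟩ := exists_orthogonal_decomposition π hu
  have hN : DirectSum.IsInternal (fun W : S => (W : Submodule ℂ V)) :=
    isInternal_of_pairwise_isOrtho S horth hsup
  have hst : ∀ W ∈ S, IsStable π W := fun W hW => (hirr W hW).2.1
  -- the integral as a sum of multiplicities
  have hchar : ∀ g, character π g = ∑ W : S, character (restrictRep π W (hst W W.property)) g :=
    character_eq_sum_restrict_finset π S hN hst
  have hsum : ∫ g, character π g * conj (character π g) ∂μ =
      ∑ W' : S, ((Finset.univ.filter fun W : S => Nonempty (Representation.Equiv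
        (toRep (restrictRep π W' (hst W' W'.property))) (toRep (restrictRep π W (hst W W.property))))).card : ℂ) := by
    have hexp : (fun g => character π g * conj (character π g)) =
        fun g => ∑ W' : S, character π g * conj (character (restrictRep π W' (hst W' W'.property)) g) := by
      funext g
      conv_lhs => rw [hchar g]
      rw [map_sum, Finset.mul_sum]
      refine Finset.sum_congr rfl fun W' _ => ?_
      rw [← hchar g]
    rw [hexp, integral_finsetSum _ (fun W' _ => ?_)]
    · refine Finset.sum_congr rfl fun W' _ => ?_
      haveI : Nontrivial W' := nontrivial_of_isIrreducibleSubspace π W' (hirr W' W'.property)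
      haveI : Representation.IsIrreducible (toRep (restrictRep π W' (hst W' W'.property))) :=
        (isIrreducible_iff _).mp
          (isIrreducible_restrictRep π W' (hirr W' W'.property) (hst W' W'.property))
      exact integral_character_mul_conj_eq_card' π (restrictRep π W' (hst W' W'.property)) μ hπ
        (continuous_restrictRep π hπ W' (hst W' W'.property))
        (isUnitary_restrictRep π hu W' (hst W' W'.property)) S hirr hst hN
    · exact ((continuous_character π hπ).mul (Complex.continuous_conj.comp (continuous_character _
        (continuous_restrictRep π hπ W' (hst W' W'.property))))).integrable_of_hasCompactSupport
        (HasCompactSupport.of_compactSpace _)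
  -- each multiplicity is ≥ 1 (a summand is equivalent to itself), so #S ≤ 1
  have hge : ∀ W' : S, 1 ≤ (Finset.univ.filter fun W : S => Nonempty (Representation.Equiv
      (toRep (restrictRep π W' (hst W' W'.property))) (toRep (restrictRep π W (hst W W.property))))).card := by
    intro W'
    apply Finset.card_pos.mpr
    exact ⟨W', Finset.mem_filter.mpr ⟨Finset.mem_univ _, ⟨Representation.Equiv.refl _⟩⟩⟩
  have hnat : (∑ W' : S, (Finset.univ.filter fun W : S => Nonempty (Representation.Equiv
      (toRep (restrictRep π W' (hst W' W'.property))) (toRep (restrictRep π W (hst W W.property))))).card) = 1 := by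
    have h2 := h1
    rw [hsum] at h2
    exact_mod_cast h2
  have hcard : S.card ≤ 1 := by
    have h3 : ∑ W' : S, 1 ≤ ∑ W' : S, (Finset.univ.filter fun W : S => Nonempty (Representation.Equiv
        (toRep (restrictRep π W' (hst W' W'.property))) (toRep (restrictRep π W (hst W W.property))))).card :=
      Finset.sum_le_sum fun W' _ => hge W'
    rw [hnat] at h3
    simpa [Finset.card_univ, Fintype.card_coe] using h3
  -- S is non-empty because its supremum is ⊤ ≠ ⊥
  have hne : S.Nonempty := by
    by_contra h
    rw [Finset.not_nonempty_iff_eq_empty] at h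
    rw [h, Finset.sup_empty] at hsup
    exact bot_ne_top hsup
  have hcard1 : S.card = 1 := le_antisymm hcard (Finset.card_pos.mpr hne)
  obtain ⟨W, hW⟩ := Finset.card_eq_one.mp hcard1
  rw [hW, Finset.sup_singleton, id] at hsup
  have hWirr : IsIrreducibleSubspace π W := hirr W (by rw [hW]; exact Finset.mem_singleton_self W)
  rw [hsup] at hWirr
  exact (isIrreducibleSubspace_top_iff π).mp hWirr

open scoped Classical in
/-- The character criterion both ways: `π` (unitary, continuous, `V ≠ 0`) is irreducible iff
`∫ |χ_π|² dμ = 1`. -/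
theorem isIrreducible_iff_integral_character_mul_conj_eq_one [Nontrivial V] (μ : Measure G)
    [IsProbabilityMeasure μ] [μ.IsMulLeftInvariant] (hπ : Continuous π) (hu : IsUnitary π) :
    IsIrreducible π ↔ ∫ g, character π g * conj (character π g) ∂μ = 1 :=
  ⟨fun h => integral_character_mul_conj π μ hπ hu h,
    fun h => isIrreducible_of_integral_character_mul_conj_eq_one π μ hπ hu h⟩

end Summit.Ventures.HodgeRepro2.T5Multiplicity
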